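import Summits.HodgeConjecture.HodgeConjecture.Theorems.H413SpectrumCompleteness
import Summits.HodgeConjecture.HodgeConjecture.Theorems.P2StubU2lL2Realisation
import HarnessLib

/-!
# FLOOR-0 junction T7 AT THE FACTOR OF RECORD `𝔞₀ = archFactorOf F V`: the pin lemmas with the continuity and honesty hypotheses
# DISCHARGED (★ `P2StubU2lL2Realisation.continuous_of_mem_cohForms`, ★ `P4StubT1ArchFactor.archFactorOf_isHonest`)

Cell hodgecm-mathlib, FLOOR 0; crux item H413 = stmt-HodgeConjecture-24833 (route `HCCMUnconditional`); prover F0P3-p04 (g0),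
share «junction T7».  PROOF FILE: theorems only — no definition, no instance, no notation, no named fact, no `sorry`.
HONEST LABEL: HC_CM is proved only modulo the printed citations until rung 0 closes.

The pin lemmas of ★ `Theorems/H413SpectrumJunctionPin.lean` / ★ `H413SpectrumPartsPin.lean` carry `Continuous (fun x => ψ w x j)` and
`𝔞.IsHonest` as HYPOTHESES (the carrier `holCotForms 𝔞` has no continuity conjunct).  At the factor of record both are THEOREMS:
continuity of every member of `cohForms (archFactorOf F V)` is F0P2-p01 (g0)'s ★ `P2StubU2lL2Realisation.continuous_of_mem_cohForms`
(p792655) and honesty is ★ `archFactorOf_isHonest`.  This file records the hypothesis-free forms the folds consume: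
* `continuous_apply_of_mem_cohForms_record` (coordinates are continuous), `memLp_toQuotFun_record`;
* J3 `hasFinComponent_of_equivariant_record` / `_hol_record` / `_antihol_record` — an IRREDUCIBLE `σ` on `W` (e.g. the pin's `ω_V(t)`), a
  NON-ZERO `rightRep F V`-equivariant linear `ψ : W → (U(V)(𝔸_{F⁺}) → ℂ²)` valued in `cohForms 𝔞₀` (resp. `holCotForms 𝔞₀`, its
  `conjFun` image) and contained in the discrete automorphic `P` (`P.ContainsForm (ψ w)` for all `w`) gives `P.HasFinComponent σ` —
  only `4 ≤ [F:ℚ]` remains as a hypothesis;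
* `transport_of_descents_record`, `rightRep_mem_cotPart_record` / `_holPart_record` / `_antiholPart_record` (g2 at `𝔞₀`, no honesty binder).

## References
* [BorelJacquet1979] A. Borel, H. Jacquet, PSPM 33.1 (1979), §4.2, §4.6.
* [GelfandGraevPiatetskiShapiro1969] I. M. Gelfand, M. I. Graev, I. I. Piatetski-Shapiro (1969), Ch. 1 §2.3.
* [BorelWallach2000] A. Borel, N. Wallach, 2nd ed. (2000), VII 3.2.
-/

set_option autoImplicit false

-- the mandated namespace has the single-problem summit's repeated segment (`HodgeConjecture.HodgeConjecture`)
set_option linter.dupNamespace false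

noncomputable section

namespace Summit.HodgeConjecture.HodgeConjecture.Cruxes.H413.SpectrumJunction

open MeasureTheory NumberField Topology
open scoped ENNReal
open Literature.NumberTheory.Automorphic Literature.NumberTheory.Automorphic.UnitaryGroup
open Literature.NumberTheory.Automorphic.UnitaryGroup.CotangentForms (toQuotFun)
open Summit.HodgeConjecture.HodgeConjecture.Cruxes.H413.CohFormsCarriers

section Record

variable {F : HodgeCM.CMField} {ι₁ : F →+* ℂ} {V : HodgeCM.HermSpace3 F ι₁}

/-- **Coordinates of cotangent forms for the factor of record are continuous** (★ `P2StubU2lL2Realisation.continuous_of_mem_cohForms`,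
F0P2-p01 (g0), composed with the coordinate projection). [cite: BorelJacquet1979, §4.2] -/
theorem continuous_apply_of_mem_cohForms_record {f : (adelicDatum F V).Adelic → (Fin 2 → ℂ)} (hf : f ∈ cohForms (archFactorOf F V))
    (j : Fin 2) : Continuous fun x => f x j :=
  (continuous_apply j).comp (P2StubU2lL2Realisation.continuous_of_mem_cohForms F V hf)

/-- **`L^p`-membership of the coordinates of cotangent forms for the factor of record** (`4 ≤ [F:ℚ]`, finite measure), no continuity
hypothesis. [cite: GelfandGraevPiatetskiShapiro1969, Ch. 1 §2.3] -/
theorem memLp_toQuotFun_record (h4 : 4 ≤ Module.finrank ℚ F) {μ : Measure (adelicDatum F V).automorphicQuotient} [IsFiniteMeasure μ]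
    {f : (adelicDatum F V).Adelic → (Fin 2 → ℂ)} (hf : f ∈ cohForms (archFactorOf F V)) (j : Fin 2) (p : ℝ≥0∞) :
    MemLp (toQuotFun (adelicDatum F V) fun x => f x j) p μ :=
  memLp_toQuotFun_pin h4 hf j (continuous_apply_of_mem_cohForms_record hf j) p

/-- **J3 AT THE FACTOR OF RECORD** (values in `cohForms 𝔞₀`; no continuity hypothesis): an irreducible `σ` with a non-zero `rightRep F V`-equivariant
`cohForms 𝔞₀`-valued `ψ` contained in the discrete automorphic `P` OCCURS in `P`. [cite: BorelJacquet1979, §4.6] -/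
theorem hasFinComponent_of_equivariant_record (h4 : 4 ≤ Module.finrank ℚ F)
    {μ : Measure (adelicDatum F V).automorphicQuotient} [(adelicDatum F V).IsAutomorphicMeasure μ]
    (P : DiscreteAutomorphicRep (adelicDatum F V) μ)
    {W : Type} [AddCommGroup W] [Module ℂ W] (σ : Representation ℂ ↥(HodgeCM.HermSpace3.adelicFin V) W)
    (hσ : σ.IsIrreducible) (ψ : W →ₗ[ℂ] ((adelicDatum F V).Adelic → (Fin 2 → ℂ)))
    (hψ : ∀ (g : ↥(HodgeCM.HermSpace3.adelicFin V)) (w : W), ψ (σ g w) = rightRep F V g (ψ w))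
    (hvals : ∀ w, ψ w ∈ cohForms (archFactorOf F V)) (hP : ∀ w, P.ContainsForm (ψ w)) (hne : ψ ≠ 0) : P.HasFinComponent σ :=
  hasFinComponent_of_equivariant_pin h4 P σ hσ ψ hψ hvals (fun w j => continuous_apply_of_mem_cohForms_record (hvals w) j) hP hne

/-- **J3 AT THE FACTOR OF RECORD, holomorphic values** (stubs S3 / S5): as above with `ψ` valued in `holCotForms 𝔞₀`. [cite: BorelJacquet1979, §4.6] -/
theorem hasFinComponent_of_equivariant_hol_record (h4 : 4 ≤ Module.finrank ℚ F)
    {μ : Measure (adelicDatum F V).automorphicQuotient} [(adelicDatum F V).IsAutomorphicMeasure μ]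
    (P : DiscreteAutomorphicRep (adelicDatum F V) μ)
    {W : Type} [AddCommGroup W] [Module ℂ W] (σ : Representation ℂ ↥(HodgeCM.HermSpace3.adelicFin V) W)
    (hσ : σ.IsIrreducible) (ψ : W →ₗ[ℂ] ((adelicDatum F V).Adelic → (Fin 2 → ℂ)))
    (hψ : ∀ (g : ↥(HodgeCM.HermSpace3.adelicFin V)) (w : W), ψ (σ g w) = rightRep F V g (ψ w))
    (hvals : ∀ w, ψ w ∈ holCotForms (archFactorOf F V)) (hP : ∀ w, P.ContainsForm (ψ w)) (hne : ψ ≠ 0) : P.HasFinComponent σ :=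
  hasFinComponent_of_equivariant_record h4 P σ hσ ψ hψ (fun w => Submodule.mem_sup_left (hvals w)) hP hne

/-- **J3 AT THE FACTOR OF RECORD, antiholomorphic values** (stubs S4 / S5): as above with `ψ` valued in `(holCotForms 𝔞₀).map conjFun`.
[cite: BorelJacquet1979, §4.6] -/
theorem hasFinComponent_of_equivariant_antihol_record (h4 : 4 ≤ Module.finrank ℚ F)
    {μ : Measure (adelicDatum F V).automorphicQuotient} [(adelicDatum F V).IsAutomorphicMeasure μ]
    (P : DiscreteAutomorphicRep (adelicDatum F V) μ)
    {W : Type} [AddCommGroup W] [Module ℂ W] (σ : Representation ℂ ↥(HodgeCM.HermSpace3.adelicFin V) W)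
    (hσ : σ.IsIrreducible) (ψ : W →ₗ[ℂ] ((adelicDatum F V).Adelic → (Fin 2 → ℂ)))
    (hψ : ∀ (g : ↥(HodgeCM.HermSpace3.adelicFin V)) (w : W), ψ (σ g w) = rightRep F V g (ψ w))
    (hvals : ∀ w, ψ w ∈ (holCotForms (archFactorOf F V)).map (conjFun F V)) (hP : ∀ w, P.ContainsForm (ψ w)) (hne : ψ ≠ 0) :
    P.HasFinComponent σ :=
  hasFinComponent_of_equivariant_record h4 P σ hσ ψ hψ (fun w => Submodule.mem_sup_right (hvals w)) hP hne

/-- **TRANSPORT AT THE FACTOR OF RECORD** under continuous descents (`hrep` = programme P2's `Represents F V (archFactorOf F V) μ ℓ` unfolded):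
`ℓ (rightRep F V g f) k = R(1, g) (ℓ f k)` for `f ∈ cohForms 𝔞₀` (no honesty binder). [cite: BorelJacquet1979, §4.6] -/
theorem transport_of_descents_record (h4 : 4 ≤ Module.finrank ℚ F) {μ : Measure (adelicDatum F V).automorphicQuotient}
    [(adelicDatum F V).IsAutomorphicMeasure μ]
    (ℓ : ((adelicDatum F V).Adelic → (Fin 2 → ℂ)) →ₗ[ℂ] (Fin 2 → (adelicDatum F V).L2 μ))
    (hrep : ∀ f ∈ cohForms (archFactorOf F V), ∀ k : Fin 2, ∃ φ : C((adelicDatum F V).automorphicQuotient, ℂ),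
      (∀ h, φ ((adelicDatum F V).toAutomorphicQuotient h) = f h⁻¹ k) ∧
        (((ℓ f k : (adelicDatum F V).L2 μ) : (adelicDatum F V).automorphicQuotient → ℂ) =ᵐ[μ] ⇑φ))
    {f : (adelicDatum F V).Adelic → (Fin 2 → ℂ)} (hf : f ∈ cohForms (archFactorOf F V)) (g : ↥(HodgeCM.HermSpace3.adelicFin V))
    (k : Fin 2) : ℓ (rightRep F V g f) k = (adelicDatum F V).rightRegular μ (finToAdelic F V g) (ℓ f k) :=
  transport_of_descents h4 (P4StubT1ArchFactor.archFactorOf_isHonest F V) ℓ hrep hf g k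

/-- **g2 AT THE FACTOR OF RECORD (cotangent part)**: `rightRep F V g` preserves `cohForms 𝔞₀ ⊓ ⨅ k, P.space.comap (proj k ∘ ℓ)` (programme P2's
`cotPart 𝔞₀ μ ℓ P`), no honesty binder. [cite: BorelJacquet1979, §4.2, §4.6] -/
theorem rightRep_mem_cotPart_record (h4 : 4 ≤ Module.finrank ℚ F) {μ : Measure (adelicDatum F V).automorphicQuotient}
    [(adelicDatum F V).IsAutomorphicMeasure μ]
    (ℓ : ((adelicDatum F V).Adelic → (Fin 2 → ℂ)) →ₗ[ℂ] (Fin 2 → (adelicDatum F V).L2 μ))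
    (hrep : ∀ f ∈ cohForms (archFactorOf F V), ∀ k : Fin 2, ∃ φ : C((adelicDatum F V).automorphicQuotient, ℂ),
      (∀ h, φ ((adelicDatum F V).toAutomorphicQuotient h) = f h⁻¹ k) ∧
        (((ℓ f k : (adelicDatum F V).L2 μ) : (adelicDatum F V).automorphicQuotient → ℂ) =ᵐ[μ] ⇑φ))
    (P : DiscreteAutomorphicRep (adelicDatum F V) μ) (g : ↥(HodgeCM.HermSpace3.adelicFin V))
    {f : (adelicDatum F V).Adelic → (Fin 2 → ℂ)}
    (hf : f ∈ cohForms (archFactorOf F V) ⊓ ⨅ k : Fin 2, (P.space.toSubmodule).comap ((LinearMap.proj k).comp ℓ)) :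
    rightRep F V g f ∈ cohForms (archFactorOf F V) ⊓ ⨅ k : Fin 2, (P.space.toSubmodule).comap ((LinearMap.proj k).comp ℓ) :=
  rightRep_mem_cotPart_pin h4 (P4StubT1ArchFactor.archFactorOf_isHonest F V) ℓ hrep P g hf

/-- **g2 AT THE FACTOR OF RECORD (holomorphic part)** (programme P2's `holPart 𝔞₀ μ ℓ P`). [cite: BorelJacquet1979, §4.2, §4.6] -/
theorem rightRep_mem_holPart_record (h4 : 4 ≤ Module.finrank ℚ F) {μ : Measure (adelicDatum F V).automorphicQuotient}
    [(adelicDatum F V).IsAutomorphicMeasure μ]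
    (ℓ : ((adelicDatum F V).Adelic → (Fin 2 → ℂ)) →ₗ[ℂ] (Fin 2 → (adelicDatum F V).L2 μ))
    (hrep : ∀ f ∈ cohForms (archFactorOf F V), ∀ k : Fin 2, ∃ φ : C((adelicDatum F V).automorphicQuotient, ℂ),
      (∀ h, φ ((adelicDatum F V).toAutomorphicQuotient h) = f h⁻¹ k) ∧
        (((ℓ f k : (adelicDatum F V).L2 μ) : (adelicDatum F V).automorphicQuotient → ℂ) =ᵐ[μ] ⇑φ))
    (P : DiscreteAutomorphicRep (adelicDatum F V) μ) (g : ↥(HodgeCM.HermSpace3.adelicFin V))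
    {f : (adelicDatum F V).Adelic → (Fin 2 → ℂ)}
    (hf : f ∈ holCotForms (archFactorOf F V) ⊓ ⨅ k : Fin 2, (P.space.toSubmodule).comap ((LinearMap.proj k).comp ℓ)) :
    rightRep F V g f ∈ holCotForms (archFactorOf F V) ⊓ ⨅ k : Fin 2, (P.space.toSubmodule).comap ((LinearMap.proj k).comp ℓ) :=
  rightRep_mem_holPart_pin h4 (P4StubT1ArchFactor.archFactorOf_isHonest F V) ℓ hrep P g hf

/-- **g2 AT THE FACTOR OF RECORD (antiholomorphic part)** (programme P2's `antiholPart 𝔞₀ μ ℓ P`). [cite: BorelJacquet1979, §4.2, §4.6] -/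
theorem rightRep_mem_antiholPart_record (h4 : 4 ≤ Module.finrank ℚ F) {μ : Measure (adelicDatum F V).automorphicQuotient}
    [(adelicDatum F V).IsAutomorphicMeasure μ]
    (ℓ : ((adelicDatum F V).Adelic → (Fin 2 → ℂ)) →ₗ[ℂ] (Fin 2 → (adelicDatum F V).L2 μ))
    (hrep : ∀ f ∈ cohForms (archFactorOf F V), ∀ k : Fin 2, ∃ φ : C((adelicDatum F V).automorphicQuotient, ℂ),
      (∀ h, φ ((adelicDatum F V).toAutomorphicQuotient h) = f h⁻¹ k) ∧
        (((ℓ f k : (adelicDatum F V).L2 μ) : (adelicDatum F V).automorphicQuotient → ℂ) =ᵐ[μ] ⇑φ))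
    (P : DiscreteAutomorphicRep (adelicDatum F V) μ) (g : ↥(HodgeCM.HermSpace3.adelicFin V))
    {f : (adelicDatum F V).Adelic → (Fin 2 → ℂ)}
    (hf : f ∈ (holCotForms (archFactorOf F V)).map (conjFun F V) ⊓
      ⨅ k : Fin 2, (P.space.toSubmodule).comap ((LinearMap.proj k).comp ℓ)) :
    rightRep F V g f ∈ (holCotForms (archFactorOf F V)).map (conjFun F V) ⊓
      ⨅ k : Fin 2, (P.space.toSubmodule).comap ((LinearMap.proj k).comp ℓ) :=
  rightRep_mem_antiholPart_pin h4 (P4StubT1ArchFactor.archFactorOf_isHonest F V) ℓ hrep P g hf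

end Record

end Summit.HodgeConjecture.HodgeConjecture.Cruxes.H413.SpectrumJunction

end
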